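import Literature.Computability.Complexity.BooleanFourier
import Literature.Computability.Complexity.BlockSensitivity
import HarnessLib

/-!
# The (Fourier) degree of a Boolean function; maxonomials and Midrijanis' lemma

The degree `deg(f)` of a total Boolean function `f : {0,1}ᴺ → {0,1}` is the degree of the
unique multilinear real polynomial representing it; "the degree of `f` as a polynomial is also
called the Fourier-degree of `f`, which equals `max {|S| : f̂(S) ≠ 0}`" (Aaronson–Ben-David–
Kothari–Rao–Tal, STOC 2021, §2.3). We take the Fourier side as the definition, on top of the
tree's Fourier–Walsh expansion `cubeFourierCoeff` (`BooleanFourier.lean`, O'Donnell 2014, Ch. 1,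
§3.3):

* `fourierDegree g` — `max {|S| : ĝ(S) ≠ 0}` for a real function `g` on `{0,1}ᴺ` (`0` for
  `g = 0`); `booleanDegree f = deg(f)` — the Fourier degree of the `0/1`-valued `realOf f`;
* `card_le_fourierDegree`, `cubeFourierCoeff_eq_zero_of_lt` (the defining property),
  `cubeFourierCoeff_eq_zero_of_forall_eq` / `exists_ne_of_cubeFourierCoeff_ne_zero` (a function
  with a nonzero coefficient at some `S ≠ ∅` is not constant), `exists_maxonomial` (a
  non-constant function has a *maxonomial*: `ĝ(S) ≠ 0`, `|S| = deg`, `S ≠ ∅`);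
* restrictions `x ↦ g(x|_{J ← σ})` (Mathlib's `J.piecewise σ x`): `fourierDegree_piecewise_le`
  (restricting does not raise the degree) and `cubeFourierCoeff_piecewise_of_maxonomial` (fixing
  variables OUTSIDE a maxonomial `S₀` leaves the coefficient at `S₀` unchanged — "this `g`
  contains monomial `M` therefore it cannot be constant");
* **Midrijanis' Lemma 3** (`exists_sensitive_block_subset_maxonomial`): "For every word
  `w ∈ {0,1}ᴺ` and every maxonomial `M` of `f`, there is a set `B` of variables in `M` such that
  `f(w^B) ≠ f(w)`" — with `w^B = flipBlock w B` of `BlockSensitivity.lean`.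

These are the degree-side ingredients of Midrijanis' `D(f) ≤ bs(f) · deg(f)` (file
`MidrijanisBound.lean`) and of Huang's `deg(f) ≤ λ(f)²`, hence of `D(f) = O(Q(f)⁴)`.

## References

* G. Midrijanis, *Exact quantum query complexity for total Boolean functions*,
  arXiv:quant-ph/0403168 (2004), §2 ("unique multilinear polynomial … `deg(f)`"), Lemma 3
  [Midrijanis2004].
* S. Aaronson, S. Ben-David, R. Kothari, S. Rao, A. Tal, *Degree vs. approximate degree and
  quantum implications of Huang's sensitivity theorem*, STOC 2021 (arXiv:2010.12629), §2.3
  [AaronsonBenDavidKothariRaoTal2021].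
* R. O'Donnell, *Analysis of Boolean Functions*, CUP 2014, §1.2–1.4, Prop. 3.21 [ODonnell2014].
-/

noncomputable section

namespace Literature.Computability.Complexity

open Finset LowDegree Literature.Probability.RandomGraphs.LowDegree

variable {N : ℕ}

/-! ### Fourier degree -/

/-- The Fourier degree `max {|S| : ĝ(S) ≠ 0}` of a real function on the cube `{0,1}ᴺ` (`0` when
all coefficients vanish, i.e. `g = 0`). [cite: AaronsonBenDavidKothariRaoTal2021, §2.3] -/
def fourierDegree (g : (Fin N → Bool) → ℝ) : ℕ :=
  (Finset.univ.filter fun S : Finset (Fin N) => cubeFourierCoeff g S ≠ 0).sup Finset.card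

/-- The `0/1`-valued real function of a Boolean function (`true ↦ 1`, `false ↦ 0`), the function
represented by "the unique multilinear polynomial `g` such that `f(x) = g(x)` for all
`x ∈ {0,1}ᴺ`". [cite: Midrijanis2004, §2] -/
def realOf (f : (Fin N → Bool) → Bool) : (Fin N → Bool) → ℝ := fun x => if f x then 1 else 0

/-- `realOf f x = 1` if `f x`, else `0`. [folklore] -/
@[simp] theorem realOf_apply (f : (Fin N → Bool) → Bool) (x : Fin N → Bool) :
    realOf f x = if f x then 1 else 0 := rfl

/-- `realOf` is injective on values: `realOf f x = realOf f y ↔ f x = f y`. [folklore] -/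
theorem realOf_eq_realOf_iff (f : (Fin N → Bool) → Bool) (x y : Fin N → Bool) :
    realOf f x = realOf f y ↔ f x = f y := by
  cases hx : f x <;> cases hy : f y <;> simp [realOf, hx, hy]

/-- The degree `deg(f)` of a total Boolean function: the degree of its representing multilinear
polynomial, equivalently its Fourier degree `max {|S| : f̂(S) ≠ 0}`. [cite:
AaronsonBenDavidKothariRaoTal2021, §2.3] -/
def booleanDegree (f : (Fin N → Bool) → Bool) : ℕ := fourierDegree (realOf f)

/-- A set carrying a nonzero coefficient has size at most the degree. [cite:
AaronsonBenDavidKothariRaoTal2021, §2.3] -/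
theorem card_le_fourierDegree {g : (Fin N → Bool) → ℝ} {S : Finset (Fin N)}
    (h : cubeFourierCoeff g S ≠ 0) : S.card ≤ fourierDegree g := by
  classical
  exact Finset.le_sup (f := Finset.card) (by simpa using h)

/-- Coefficients above the degree vanish. [cite: AaronsonBenDavidKothariRaoTal2021, §2.3] -/
theorem cubeFourierCoeff_eq_zero_of_lt {g : (Fin N → Bool) → ℝ} {S : Finset (Fin N)}
    (h : fourierDegree g < S.card) : cubeFourierCoeff g S = 0 := by
  by_contra hne
  exact absurd (card_le_fourierDegree hne) (not_le.mpr h)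

/-- The degree is at most the number of variables. [folklore] -/
theorem fourierDegree_le (g : (Fin N → Bool) → ℝ) : fourierDegree g ≤ N := by
  classical
  refine Finset.sup_le fun S _ => ?_
  simpa using Finset.card_le_univ S

/-- `deg(f) ≤ N`. [folklore] -/
theorem booleanDegree_le (f : (Fin N → Bool) → Bool) : booleanDegree f ≤ N :=
  fourierDegree_le _

/-! ### Constancy and maxonomials -/

/-- `∑_x χ_S(x) = 0` for `S ≠ ∅`. [cite: ODonnell2014, §1.4] -/
theorem sum_walsh_eq_zero_of_nonempty {S : Finset (Fin N)} (hS : S.Nonempty) :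
    ∑ x : Fin N → Bool, walsh S x = 0 := by
  have h := sum_walsh_mul_walsh_index S (∅ : Finset (Fin N))
  simp only [walsh_empty, mul_one] at h
  rw [h, if_neg hS.ne_empty]

/-- A constant function has vanishing coefficients at every nonempty `S`. [cite: ODonnell2014,
§1.2] -/
theorem cubeFourierCoeff_eq_zero_of_forall_eq {g : (Fin N → Bool) → ℝ} (hg : ∀ x y, g x = g y)
    {S : Finset (Fin N)} (hS : S.Nonempty) : cubeFourierCoeff g S = 0 := by
  classical
  unfold cubeFourierCoeff
  have hc : ∀ x, g x = g (fun _ => false) := fun x => hg x _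
  simp_rw [hc, ← Finset.mul_sum, sum_walsh_eq_zero_of_nonempty hS]
  simp

/-- A function with a nonzero coefficient at a nonempty `S` is not constant. [cite: ODonnell2014,
§1.2] -/
theorem exists_ne_of_cubeFourierCoeff_ne_zero {g : (Fin N → Bool) → ℝ} {S : Finset (Fin N)}
    (hS : S.Nonempty) (h : cubeFourierCoeff g S ≠ 0) : ∃ x y, g x ≠ g y := by
  by_contra hc
  push Not at hc
  exact h (cubeFourierCoeff_eq_zero_of_forall_eq hc hS)

/-- A function all of whose coefficients at nonempty sets vanish is the constant `ĝ(∅)` (Fourier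
inversion). [cite: ODonnell2014, Thm 1.1] -/
theorem eq_cubeFourierCoeff_empty {g : (Fin N → Bool) → ℝ}
    (h : ∀ S : Finset (Fin N), S.Nonempty → cubeFourierCoeff g S = 0) (x : Fin N → Bool) :
    g x = cubeFourierCoeff g ∅ := by
  rw [← sum_cubeFourierCoeff_mul_walsh g x, Finset.sum_eq_single ∅]
  · simp
  · intro S _ hS
    rw [h S (Finset.nonempty_iff_ne_empty.mpr hS), zero_mul]
  · simp

/-- A non-constant function has a nonzero coefficient at some nonempty set. [cite: ODonnell2014,
Thm 1.1] -/
theorem exists_cubeFourierCoeff_ne_zero {g : (Fin N → Bool) → ℝ} {x y : Fin N → Bool}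
    (hxy : g x ≠ g y) : ∃ S : Finset (Fin N), S.Nonempty ∧ cubeFourierCoeff g S ≠ 0 := by
  by_contra h
  push Not at h
  exact hxy ((eq_cubeFourierCoeff_empty h x).trans (eq_cubeFourierCoeff_empty h y).symm)

/-- **Maxonomials exist**: a non-constant function has a nonempty `S` with `ĝ(S) ≠ 0` and
`|S| = deg` ("maxonomial of polynomial `f` is a monomial with maximal degree"). [cite:
Midrijanis2004, §3 (before Lemma 3)] -/
theorem exists_maxonomial {g : (Fin N → Bool) → ℝ} {x y : Fin N → Bool} (hxy : g x ≠ g y) :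
    ∃ S : Finset (Fin N), S.Nonempty ∧ cubeFourierCoeff g S ≠ 0 ∧ S.card = fourierDegree g := by
  classical
  obtain ⟨S₁, hS₁, hc₁⟩ := exists_cubeFourierCoeff_ne_zero hxy
  obtain ⟨S, hS, hcard⟩ := Finset.exists_mem_eq_sup
    (Finset.univ.filter fun S : Finset (Fin N) => cubeFourierCoeff g S ≠ 0)
    ⟨S₁, by simpa using hc₁⟩ Finset.card
  have hSc : cubeFourierCoeff g S ≠ 0 := by simpa using hS
  have hcard' : S.card = fourierDegree g := hcard.symm
  refine ⟨S, ?_, hSc, hcard'⟩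
  rw [← Finset.card_pos, hcard']
  exact lt_of_lt_of_le (Finset.card_pos.mpr hS₁) (card_le_fourierDegree hc₁)

/-- A non-constant function has degree at least `1`. [folklore] -/
theorem one_le_fourierDegree {g : (Fin N → Bool) → ℝ} {x y : Fin N → Bool} (hxy : g x ≠ g y) :
    1 ≤ fourierDegree g := by
  obtain ⟨S, hS, -, hcard⟩ := exists_maxonomial hxy
  rw [← hcard]
  exact Finset.card_pos.mpr hS

/-! ### Restrictions do not raise the degree; maxonomials survive restriction outside them -/

/-- Restricting (fixing the coordinates in `J` to `σ`) kills every coefficient above the degree of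
the original function. [cite: ODonnell2014, Prop. 3.21] -/
theorem cubeFourierCoeff_piecewise_eq_zero_of_lt (g : (Fin N → Bool) → ℝ) (J : Finset (Fin N))
    (σ : Fin N → Bool) {T : Finset (Fin N)} (hT : fourierDegree g < T.card) :
    cubeFourierCoeff (fun x => g (J.piecewise σ x)) T = 0 := by
  classical
  rw [cubeFourierCoeff_piecewise]
  refine Finset.sum_eq_zero fun S _ => ?_
  split_ifs with h
  · have hTS : T ⊆ S := by rw [← h]; exact Finset.filter_subset _ _
    have hlt : fourierDegree g < S.card := lt_of_lt_of_le hT (Finset.card_le_card hTS)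
    rw [cubeFourierCoeff_eq_zero_of_lt hlt, zero_mul]
  · rfl

/-- **Restriction does not raise the degree**: `deg g|_{J ← σ} ≤ deg g` ("at every moment
`deg(p) ≤ deg(f)`"). [cite: Midrijanis2004, Thm 4 (proof)] -/
theorem fourierDegree_piecewise_le (g : (Fin N → Bool) → ℝ) (J : Finset (Fin N))
    (σ : Fin N → Bool) : fourierDegree (fun x => g (J.piecewise σ x)) ≤ fourierDegree g := by
  classical
  refine Finset.sup_le fun T hT => ?_
  have hTc : cubeFourierCoeff (fun x => g (J.piecewise σ x)) T ≠ 0 := by simpa using hT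
  by_contra hlt
  push Not at hlt
  exact hTc (cubeFourierCoeff_piecewise_eq_zero_of_lt g J σ hlt)

/-- The Boolean form: `deg (f|_{J ← σ}) ≤ deg f`. [cite: Midrijanis2004, Thm 4 (proof)] -/
theorem booleanDegree_piecewise_le (f : (Fin N → Bool) → Bool) (J : Finset (Fin N))
    (σ : Fin N → Bool) : booleanDegree (fun x => f (J.piecewise σ x)) ≤ booleanDegree f :=
  fourierDegree_piecewise_le (realOf f) J σ

/-- **A maxonomial survives fixing the variables outside it**: if `ĝ(S₀) ≠ 0`, `|S₀| = deg g` and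
`J ∩ S₀ = ∅`, then the restriction `g|_{J ← σ}` has the same coefficient at `S₀` ("obtain
restricted function `g` from `f` by setting all variables outside of `M` according to `w`. This
`g` contains monomial `M`"). [cite: Midrijanis2004, Lemma 3 (proof)] -/
theorem cubeFourierCoeff_piecewise_of_maxonomial (g : (Fin N → Bool) → ℝ) {S₀ : Finset (Fin N)}
    (hmax : S₀.card = fourierDegree g) {J : Finset (Fin N)} (hJ : Disjoint S₀ J)
    (σ : Fin N → Bool) :
    cubeFourierCoeff (fun x => g (J.piecewise σ x)) S₀ = cubeFourierCoeff g S₀ := by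
  classical
  rw [cubeFourierCoeff_piecewise, Finset.sum_eq_single S₀]
  · have h1 : S₀.filter (· ∉ J) = S₀ :=
      Finset.filter_true_of_mem fun i hi hiJ => Finset.disjoint_left.mp hJ hi hiJ
    have h2 : S₀.filter (· ∈ J) = ∅ :=
      Finset.filter_false_of_mem fun i hi hiJ => Finset.disjoint_left.mp hJ hi hiJ
    rw [if_pos h1, h2, Finset.prod_empty, mul_one]
  · intro S _ hS
    split_ifs with h
    · have hsub : S₀ ⊆ S := by rw [← h]; exact Finset.filter_subset _ _
      have hlt : S₀.card < S.card :=
        Finset.card_lt_card (Finset.ssubset_iff_subset_ne.mpr ⟨hsub, fun h' => hS h'.symm⟩)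
      rw [cubeFourierCoeff_eq_zero_of_lt (hmax ▸ hlt), zero_mul]
    · rfl
  · simp

/-! ### Midrijanis' Lemma 3 -/

/-- Points where `J.piecewise σ x` differs from `σ` lie outside `J`. [folklore] -/
theorem piecewise_apply_ne {J : Finset (Fin N)} {σ x : Fin N → Bool} {i : Fin N}
    (h : J.piecewise σ x i ≠ σ i) : i ∉ J := by
  classical
  intro hi
  rw [Finset.piecewise_eq_of_mem _ _ _ hi] at h
  exact h rfl

/-- `J.piecewise σ σ = σ`. [folklore] -/
theorem piecewise_self (J : Finset (Fin N)) (σ : Fin N → Bool) : J.piecewise σ σ = σ := by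
  classical
  funext i
  by_cases hi : i ∈ J
  · rw [Finset.piecewise_eq_of_mem _ _ _ hi]
  · rw [Finset.piecewise_eq_of_notMem _ _ _ hi]

/-- **Midrijanis' Lemma 3** (in Fourier form): "For every word `w ∈ {0,1}ᴺ` and every maxonomial
`M` of `f`, there is a set `B` of variables in `M` such that `f(w^B) ≠ f(w)`." Here `M = S₀` with
`f̂(S₀) ≠ 0` and `|S₀| = deg(f)`, `S₀ ≠ ∅`, and `w^B = flipBlock w B`. [cite: Midrijanis2004, Lemma 3] -/
theorem exists_sensitive_block_subset_maxonomial (f : (Fin N → Bool) → Bool)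
    {S₀ : Finset (Fin N)} (hne : S₀.Nonempty) (hS₀ : cubeFourierCoeff (realOf f) S₀ ≠ 0)
    (hmax : S₀.card = booleanDegree f) (w : Fin N → Bool) :
    ∃ B ⊆ S₀, f (flipBlock w B) ≠ f w := by
  classical
  -- restrict outside `S₀` according to `w`
  set J : Finset (Fin N) := Finset.univ \ S₀ with hJ
  have hdisj : Disjoint S₀ J := by
    rw [hJ]; exact Finset.disjoint_sdiff
  have hcoef : cubeFourierCoeff (fun x => realOf f (J.piecewise w x)) S₀ ≠ 0 := by
    rw [cubeFourierCoeff_piecewise_of_maxonomial (realOf f) hmax hdisj w]; exact hS₀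
  -- the restriction is not constant
  obtain ⟨x, y, hxy⟩ := exists_ne_of_cubeFourierCoeff_ne_zero hne hcoef
  -- one of `x`, `y` has restricted value different from `f w`
  have hw : realOf f (J.piecewise w w) = realOf f w := by rw [piecewise_self]
  obtain ⟨z, hz⟩ : ∃ z, realOf f (J.piecewise w z) ≠ realOf f w := by
    by_cases hx : realOf f (J.piecewise w x) = realOf f w
    · exact ⟨y, fun hy => hxy (hx.trans hy.symm)⟩
    · exact ⟨x, hx⟩
  refine ⟨diffSet w (J.piecewise w z), fun i hi => ?_, ?_⟩
  · have hi' : J.piecewise w z i ≠ w i := mem_diffSet.mp hi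
    have hiJ : i ∉ J := piecewise_apply_ne hi'
    simpa [hJ] using hiJ
  · rw [flipBlock_diffSet]
    exact fun h => hz ((realOf_eq_realOf_iff f _ _).mpr h)

end Literature.Computability.Complexity

end
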